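import Literature.MathematicalPhysics.StatisticalMechanics.LennardJonesClusters
import Literature.MathematicalPhysics.StatisticalMechanics.LennardJonesThermodynamicLimitProofs
import Literature.Barriers.AtomisticToContinuum.IcosahedralClusters
import HarnessLib

/-!
# Loose particles are bounded in number: the half-bound rung of `SoftKissingOrder`
# (crux `ZeroDefectDensity`, item stmt-AtomisticToContinuum-12086, line `birth`, lead c6)

The ENERGETIC stub `stub_softKissingOrder` of the line (a.e. particle of a Lennard-Jones ground
state is softly twelve-kissed two shells deep) is the bond-order half of LJ crystallization in
`d = 3`.  This file lands its first, provable rung (crux idea `half-bound-rung`, strategist census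
W3 "no loose particles"), in the strong form:

* `hb_looseParticles_card_le` — if some cluster size `k` has `E(k) < -k·τ`, then in EVERY
  Lennard-Jones ground state of EVERY size `N` the number of particles `i` with site energy
  `𝓔ⁱ(x) = ∑_{k ≠ i} V_LJ(|xᵢ - x_k|) ≥ -τ` ("`τ`-loose particles") is at most `k·(2/δ + 1)³`
  (`δ` the uniform minimal distance), a bound INDEPENDENT of `N`;
* `hb_exists_lt_of_tendsto` — the hypothesis holds for every `τ < -e_∞`, `e_∞ = lim E(N)/N`
  (Blanc–Lewin 2015 (8), proved in tree: `BlancLewin2015_8_holds`);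
* `hb_tendsto_looseDensity_zero` — hence along any sequence of ground states the FRACTION of
  `τ`-loose particles tends to `0` for every `τ < -e_∞` (the a.e. currency of the crux);
* `hb_looseParticles_card_le_seven_25` — an unconditional explicit instance, `τ = 7/25`
  (`= 3.36` bonds' worth), from the icosahedral 13-cluster `E(13) < -3.677`
  (`groundStateEnergy_thirteen_lt`, IcosahedralClusters).

Mechanism (single-particle cut-and-paste, made rigorous by the tree's double-sum bookkeeping):
for a set `L` of `τ`-loose particles that is `1`-separated (so that `V_LJ ≤ 0` between its
members), splitting `2𝓔(x) = ΣΣ_L + ΣΣ_{Lᶜ} + 2Σ_L Σ_{Lᶜ}` and using `ΣΣ_{Lᶜ} ≥ 2E(N - #L)`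
(`two_mul_groundStateEnergy_card_le`) gives `E(N) ≥ E(N - #L) - #L·τ` (`hb_removal_ineq`);
subadditivity `E(N) ≤ E(N - #L) + E(#L)` then forces `E(#L) ≥ -#L·τ`, so `#L < k` whenever
`E(k) < -kτ` (sub-subsets of `L` qualify too); a maximal `1`-separated subset of the loose set is
a `1`-net of it, and the packing bound (`card_le_of_separated_of_dist_le`, `δ`-separation from
`LennardJonesMinimalDistance_holds`) converts `#L < k` into `#loose ≤ k(2/δ+1)³`.

This is where single-particle exchange is CAPPED (census "Ladder ceiling"): it cannot see WHICH
shell binds a particle, only how much; the stub proper needs an energy ⇒ local-order inequality.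
-/

noncomputable section

namespace Summit.AtomisticToContinuum.Crystallization.Theorems.ZeroDefectDensityBirth

open Literature.MathematicalPhysics.StatisticalMechanics Filter Topology

/-- The site energy as a full sum over all indices (the diagonal term is `V_LJ(0) = 0` with
Lean's `0⁻¹ = 0`). -/
theorem hb_siteEnergy_eq_sum_univ {N : ℕ} (x : Fin N → EuclideanSpace ℝ (Fin 3)) (i : Fin N) :
    siteEnergy lennardJones x i = ∑ k, lennardJones (dist (x i) (x k)) := by
  unfold siteEnergy
  rw [← Finset.add_sum_erase Finset.univ _ (Finset.mem_univ i), dist_self, lennardJones_zero,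
    zero_add]

/-- **Removal inequality for a separated loose set.** If `x` is a Lennard-Jones ground state of
`N` particles and `L` is a set of indices, pairwise at distance `≥ 1` (so that the mutual
interactions inside `L` are `≤ 0`), each of site energy `≥ -τ`, then
`E(N - #L) - #L·τ ≤ E(N)`: the particles outside `L` form an `(N - #L)`-configuration of energy
`E(N) - Σ_{i ∈ L} 𝓔ⁱ + ΣΣ_{L×L}/2 ≤ E(N) + #L·τ`. -/
theorem hb_removal_ineq {N : ℕ} {x : Fin N → EuclideanSpace ℝ (Fin 3)}
    (hx : IsGroundState lennardJones x) (L : Finset (Fin N)) {τ : ℝ}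
    (hτ : ∀ i ∈ L, -τ ≤ siteEnergy lennardJones x i)
    (hind : ∀ i ∈ L, ∀ j ∈ L, i ≠ j → 1 ≤ dist (x i) (x j)) :
    groundStateEnergy lennardJones 3 (N - L.card) - L.card * τ ≤
      groundStateEnergy lennardJones 3 N := by
  classical
  have h2 := two_mul_interactionEnergy_eq_sum_sum lennardJones lennardJones_zero x
  rw [sum_sum_eq_add_compl _ L] at h2
  have hLc := two_mul_groundStateEnergy_card_le lennardJones lennardJones_zero
    neg_one_div_le_lennardJones hx.1 Lᶜ
  have hcard : Lᶜ.card = N - L.card := by rw [Finset.card_compl, Fintype.card_fin]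
  have hsite : ∑ i ∈ L, siteEnergy lennardJones x i =
      ∑ i ∈ L, ∑ k ∈ L, lennardJones (dist (x i) (x k)) +
        ∑ i ∈ L, ∑ k ∈ Lᶜ, lennardJones (dist (x i) (x k)) := by
    rw [← Finset.sum_add_distrib]
    refine Finset.sum_congr rfl fun i _ => ?_
    rw [hb_siteEnergy_eq_sum_univ, ← Finset.sum_add_sum_compl L]
  have hsymm : ∑ i ∈ Lᶜ, ∑ k ∈ L, lennardJones (dist (x i) (x k)) =
      ∑ i ∈ L, ∑ k ∈ Lᶜ, lennardJones (dist (x i) (x k)) := by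
    rw [Finset.sum_comm]
    exact Finset.sum_congr rfl fun i _ => Finset.sum_congr rfl fun k _ => by rw [dist_comm]
  have hLL : ∑ i ∈ L, ∑ k ∈ L, lennardJones (dist (x i) (x k)) ≤ 0 := by
    refine Finset.sum_nonpos fun i hi => Finset.sum_nonpos fun k hk => ?_
    by_cases hik : i = k
    · subst hik
      rw [dist_self, lennardJones_zero]
    · exact lennardJones_nonpos (hind i hi k hk hik)
  have hτsum : -(L.card * τ) ≤ ∑ i ∈ L, siteEnergy lennardJones x i := by
    have h := Finset.card_nsmul_le_sum L (fun i => siteEnergy lennardJones x i) (-τ) hτ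
    rw [nsmul_eq_mul] at h
    linarith
  rw [hx.2] at h2
  rw [hcard] at hLc
  linarith

/-- **Subadditivity turns removal into a lower bound on `E(#L)`.** Under the hypotheses of
`hb_removal_ineq`, `-#L·τ ≤ E(#L)`: combine `E(N - #L) - #L·τ ≤ E(N)` with
`E(N) ≤ E(N - #L) + E(#L)` (`subadditive_groundStateEnergy_lennardJones`). -/
theorem hb_neg_card_mul_le {N : ℕ} {x : Fin N → EuclideanSpace ℝ (Fin 3)}
    (hx : IsGroundState lennardJones x) (L : Finset (Fin N)) {τ : ℝ}
    (hτ : ∀ i ∈ L, -τ ≤ siteEnergy lennardJones x i)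
    (hind : ∀ i ∈ L, ∀ j ∈ L, i ≠ j → 1 ≤ dist (x i) (x j)) :
    -(L.card * τ) ≤ groundStateEnergy lennardJones 3 L.card := by
  have h1 := hb_removal_ineq hx L hτ hind
  have hle : L.card ≤ N := L.card_le_univ.trans_eq (Fintype.card_fin N)
  have hsub : groundStateEnergy lennardJones 3 (N - L.card + L.card) ≤
      groundStateEnergy lennardJones 3 (N - L.card) + groundStateEnergy lennardJones 3 L.card :=
    subadditive_groundStateEnergy_lennardJones (d := 3) (by norm_num) _ _
  rw [Nat.sub_add_cancel hle] at hsub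
  linarith

/-- **Separated loose sets are small.** If `E(k) < -kτ` for some cluster size `k`, then every
`1`-separated set of `τ`-loose particles of a ground state has fewer than `k` elements (apply
`hb_neg_card_mul_le` to a `k`-element subset). -/
theorem hb_card_lt_of_separated {N : ℕ} {x : Fin N → EuclideanSpace ℝ (Fin 3)}
    (hx : IsGroundState lennardJones x) (L : Finset (Fin N)) {τ : ℝ}
    (hτ : ∀ i ∈ L, -τ ≤ siteEnergy lennardJones x i)
    (hind : ∀ i ∈ L, ∀ j ∈ L, i ≠ j → 1 ≤ dist (x i) (x j)) {k : ℕ}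
    (hk : groundStateEnergy lennardJones 3 k < -(k * τ)) : L.card < k := by
  by_contra hle
  rw [not_lt] at hle
  obtain ⟨L', hL'L, hcard⟩ := Finset.exists_subset_card_eq hle
  have h := hb_neg_card_mul_le hx L' (fun i hi => hτ i (hL'L hi))
    (fun i hi j hj hij => hind i (hL'L hi) j (hL'L hj) hij)
  rw [hcard] at h
  linarith

/-- **A maximal `1`-separated subset is a `1`-net.** Every finite index set `Λ` contains a subset
`L`, pairwise at distance `≥ 1`, such that every point of `Λ` is within distance `< 1` of some
point of `L` (take `L` of maximal cardinality among the `1`-separated subsets). -/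
theorem hb_exists_net {N : ℕ} (x : Fin N → EuclideanSpace ℝ (Fin 3)) (Λ : Finset (Fin N)) :
    ∃ L ⊆ Λ, (∀ i ∈ L, ∀ j ∈ L, i ≠ j → 1 ≤ dist (x i) (x j)) ∧
      ∀ j ∈ Λ, ∃ i ∈ L, dist (x i) (x j) < 1 := by
  classical
  set F := Λ.powerset.filter (fun L => ∀ i ∈ L, ∀ j ∈ L, i ≠ j → 1 ≤ dist (x i) (x j))
    with hF
  have hne : F.Nonempty := ⟨∅, by simp [hF]⟩
  obtain ⟨L, hLF, hmax⟩ := F.exists_max_image Finset.card hne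
  simp only [hF, Finset.mem_filter, Finset.mem_powerset] at hLF
  refine ⟨L, hLF.1, hLF.2, fun j hj => ?_⟩
  by_contra hcon
  simp only [not_exists, not_and, not_lt] at hcon
  have hjL : j ∉ L := fun hjL => by
    have h := hcon j hjL
    rw [dist_self] at h
    norm_num at h
  have hins : insert j L ∈ F := by
    simp only [hF, Finset.mem_filter, Finset.mem_powerset]
    refine ⟨Finset.insert_subset hj hLF.1, ?_⟩
    intro a ha b hb hab
    rw [Finset.mem_insert] at ha hb
    rcases ha with rfl | haL <;> rcases hb with rfl | hbL
    · exact absurd rfl hab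
    · rw [dist_comm]
      exact hcon b hbL
    · exact hcon a haL
    · exact hLF.2 a haL b hbL hab
  have h := hmax _ hins
  rw [Finset.card_insert_of_notMem hjL] at h
  omega

/-- **Packing.** In a `δ`-separated injective configuration, at most `(2/δ + 1)³` particles lie
within distance `< 1` of a given particle (`card_le_of_separated_of_dist_le` in `ℝ³`). -/
theorem hb_card_near_le {N : ℕ} {x : Fin N → EuclideanSpace ℝ (Fin 3)}
    (hinj : Function.Injective x) {δ : ℝ} (hδ : 0 < δ)
    (hsep : ∀ i j, i ≠ j → δ ≤ dist (x i) (x j)) (i : Fin N) :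
    ((Finset.univ.filter fun j => dist (x i) (x j) < 1).card : ℝ) ≤ (2 / δ + 1) ^ 3 := by
  classical
  set S := Finset.univ.filter fun j => dist (x i) (x j) < 1 with hS
  have hcard : (S.image x).card = S.card := Finset.card_image_of_injective _ hinj
  have hs : ∀ c ∈ S.image x, dist c (x i) ≤ 1 := by
    intro c hc
    obtain ⟨j, hj, rfl⟩ := Finset.mem_image.1 hc
    have hj' : dist (x i) (x j) < 1 := by simpa [hS] using hj
    rw [dist_comm]
    exact hj'.le
  have hs' : ∀ c ∈ S.image x, ∀ d ∈ S.image x, c ≠ d → δ ≤ dist c d := by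
    intro c hc d hd hcd
    obtain ⟨j, -, rfl⟩ := Finset.mem_image.1 hc
    obtain ⟨l, -, rfl⟩ := Finset.mem_image.1 hd
    exact hsep j l fun h => hcd (by rw [h])
  have h := card_le_of_separated_of_dist_le (S.image x) (x i) hδ zero_le_one hs hs'
  rw [hcard, finrank_euclideanSpace_fin] at h
  have e : (2 : ℝ) * 1 / δ + 1 = 2 / δ + 1 := by ring
  rw [e] at h
  exact_mod_cast h

/-- **LOOSE PARTICLES ARE BOUNDED IN NUMBER (half-bound rung, strong form).** If some cluster
size `k` has `E(k) < -kτ`, then there is `K` (namely `k(2/δ + 1)³`, `δ` the uniform minimal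
distance of `LennardJonesMinimalDistance_holds`) such that every Lennard-Jones ground state, of
any number `N` of particles, has at most `K` particles of site energy `≥ -τ`. -/
theorem hb_looseParticles_card_le {τ : ℝ} {k : ℕ}
    (hk : groundStateEnergy lennardJones 3 k < -(k * τ)) :
    ∃ K : ℝ, ∀ (N : ℕ) (x : Fin N → EuclideanSpace ℝ (Fin 3)), IsGroundState lennardJones x →
      ((Finset.univ.filter fun i => -τ ≤ siteEnergy lennardJones x i).card : ℝ) ≤ K := by
  classical
  obtain ⟨δ, hδ, hsep⟩ := LennardJonesMinimalDistance_holds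
  refine ⟨k * (2 / δ + 1) ^ 3, fun N x hx => ?_⟩
  set Λ := Finset.univ.filter fun i => -τ ≤ siteEnergy lennardJones x i with hΛ
  obtain ⟨L, hLΛ, hind, hnet⟩ := hb_exists_net x Λ
  have hτL : ∀ i ∈ L, -τ ≤ siteEnergy lennardJones x i := fun i hi => by
    have h := hLΛ hi
    simpa [hΛ] using h
  have hLk : L.card < k := hb_card_lt_of_separated hx L hτL hind hk
  have hcover : Λ ⊆ L.biUnion fun i => Finset.univ.filter fun j => dist (x i) (x j) < 1 := by
    intro j hj
    obtain ⟨i, hi, hij⟩ := hnet j hj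
    exact Finset.mem_biUnion.2 ⟨i, hi, by simp [hij]⟩
  have hpos : (0 : ℝ) ≤ (2 / δ + 1) ^ 3 := by positivity
  calc (Λ.card : ℝ)
      ≤ ((L.biUnion fun i => Finset.univ.filter fun j => dist (x i) (x j) < 1).card : ℝ) := by
        exact_mod_cast Finset.card_le_card hcover
    _ ≤ ∑ i ∈ L, ((Finset.univ.filter fun j => dist (x i) (x j) < 1).card : ℝ) := by
        exact_mod_cast Finset.card_biUnion_le
    _ ≤ ∑ i ∈ L, (2 / δ + 1) ^ 3 :=
        Finset.sum_le_sum fun i _ => hb_card_near_le hx.1 hδ (hsep N x hx) i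
    _ = L.card * (2 / δ + 1) ^ 3 := by rw [Finset.sum_const, nsmul_eq_mul]
    _ ≤ k * (2 / δ + 1) ^ 3 := by
        have hLk' : (L.card : ℝ) ≤ k := by exact_mod_cast hLk.le
        exact mul_le_mul_of_nonneg_right hLk' hpos

/-- **The hypothesis `E(k) < -kτ` holds for every `τ < -e_∞`**, where `E(N)/N → e_∞`
(for Lennard-Jones in `ℝ³` the limit exists and is negative: `BlancLewin2015_8_holds`). -/
theorem hb_exists_lt_of_tendsto {e τ : ℝ}
    (he : Tendsto (fun N : ℕ => groundStateEnergy lennardJones 3 N / N) atTop (𝓝 e))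
    (hτ : τ < -e) : ∃ k : ℕ, groundStateEnergy lennardJones 3 k < -(k * τ) := by
  have hev : ∀ᶠ N : ℕ in atTop, groundStateEnergy lennardJones 3 N / N < -τ :=
    he.eventually_lt_const (by linarith)
  obtain ⟨k, hk, hk0⟩ := (hev.and (eventually_gt_atTop 0)).exists
  refine ⟨k, ?_⟩
  have hk0' : (0 : ℝ) < k := by exact_mod_cast hk0
  rw [div_lt_iff₀ hk0'] at hk
  linarith

/-- **The a.e. currency: the density of `τ`-loose particles vanishes for every `τ < -e_∞`.**
Along any sequence of Lennard-Jones ground states `x N` in `ℝ³`, the fraction of particles with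
site energy `≥ -τ` tends to `0` (indeed it is `O(1/N)`), for every `τ < -e_∞` where
`E(N)/N → e_∞`.  This is the provable first rung under the line's energetic stub
`stub_softKissingOrder` ("softly twelve-kissed a.e."): almost every particle is at least
`τ`-bound for every `τ` below the bulk binding energy per particle `|e_∞| ≈ 0.7175 = 8.61/12`. -/
theorem hb_tendsto_looseDensity_zero {e τ : ℝ}
    (he : Tendsto (fun N : ℕ => groundStateEnergy lennardJones 3 N / N) atTop (𝓝 e))
    (hτ : τ < -e) (x : (N : ℕ) → (Fin N → EuclideanSpace ℝ (Fin 3)))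
    (hx : ∀ N, IsGroundState lennardJones (x N)) :
    Tendsto (fun N : ℕ =>
      (Nat.card {i : Fin N // -τ ≤ siteEnergy lennardJones (x N) i} : ℝ) / N) atTop (𝓝 0) := by
  classical
  obtain ⟨k, hk⟩ := hb_exists_lt_of_tendsto he hτ
  obtain ⟨K, hK⟩ := hb_looseParticles_card_le hk
  have hKN : ∀ N : ℕ, (Nat.card {i : Fin N // -τ ≤ siteEnergy lennardJones (x N) i} : ℝ) ≤
      max K 0 := fun N => by
    rw [Nat.card_eq_fintype_card, Fintype.card_subtype]
    exact (hK N (x N) (hx N)).trans (le_max_left _ _)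
  refine squeeze_zero (fun N => by positivity) (fun N => ?_)
    (tendsto_const_div_atTop_nhds_zero_nat (max K 0))
  exact div_le_div_of_nonneg_right (hKN N) (Nat.cast_nonneg N)

/-- **Unconditional explicit instance (`τ = 7/25`).** The icosahedral 13-cluster gives
`E(13) < -3.677 < -13·(7/25)` (`groundStateEnergy_thirteen_lt`), so in every Lennard-Jones
ground state all but a bounded number (uniformly in `N`) of particles have site energy
`< -7/25`, i.e. more than `3.36` optimal bonds' worth of binding. -/
theorem hb_looseParticles_card_le_seven_25 :
    ∃ K : ℝ, ∀ (N : ℕ) (x : Fin N → EuclideanSpace ℝ (Fin 3)), IsGroundState lennardJones x →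
      ((Finset.univ.filter fun i => -(7 / 25 : ℝ) ≤ siteEnergy lennardJones x i).card : ℝ) ≤ K := by
  refine hb_looseParticles_card_le (k := 13) ?_
  have h := Literature.Barriers.AtomisticToContinuum.groundStateEnergy_thirteen_lt
  norm_num at h ⊢
  linarith

/-- **Sharp form in terms of the thermodynamic limit.** With `e_∞ := lim E(N)/N` (which exists,
`BlancLewin2015_8_holds`), for every `τ < -e_∞` the number of `τ`-loose particles of a
Lennard-Jones ground state is bounded uniformly in `N`. -/
theorem hb_looseParticles_card_le_of_lt_neg_lim {τ : ℝ}
    (hτ : τ < -(limUnder atTop fun N : ℕ => groundStateEnergy lennardJones 3 N / N)) :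
    ∃ K : ℝ, ∀ (N : ℕ) (x : Fin N → EuclideanSpace ℝ (Fin 3)), IsGroundState lennardJones x →
      ((Finset.univ.filter fun i => -τ ≤ siteEnergy lennardJones x i).card : ℝ) ≤ K := by
  obtain ⟨e, -, he, -⟩ := BlancLewin2015_8_holds 3 (by norm_num) (by norm_num)
  have hlim : Tendsto (fun N : ℕ => groundStateEnergy lennardJones 3 N / N) atTop
      (𝓝 (limUnder atTop fun N : ℕ => groundStateEnergy lennardJones 3 N / N)) :=
    tendsto_nhds_limUnder ⟨e, he⟩
  obtain ⟨k, hk⟩ := hb_exists_lt_of_tendsto hlim hτ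
  exact hb_looseParticles_card_le hk

/-- **REGISTERED RUNG `rung_halfBound` (one-line, fully qualified signature; sub-goal of the
energetic stub `stub_softKissingOrder` in the sense of a first rung, census W3).**  For every
`τ < -e_∞` (`E(N)/N → e_∞`), along every sequence of Lennard-Jones ground states in `ℝ³` the
fraction of particles with site energy `≥ -τ` tends to `0`.  (`hb_tendsto_looseDensity_zero`.) -/
theorem rung_halfBound : ∀ (e τ : ℝ), Filter.Tendsto (fun N : ℕ => Literature.MathematicalPhysics.StatisticalMechanics.groundStateEnergy Literature.MathematicalPhysics.StatisticalMechanics.lennardJones 3 N / (N : ℝ)) Filter.atTop (nhds e) → τ < -e → ∀ (x : (N : ℕ) → (Fin N → EuclideanSpace ℝ (Fin 3))), (∀ N, Literature.MathematicalPhysics.StatisticalMechanics.IsGroundState Literature.MathematicalPhysics.StatisticalMechanics.lennardJones (x N)) → Filter.Tendsto (fun N : ℕ => (Nat.card {i : Fin N // -τ ≤ Literature.MathematicalPhysics.StatisticalMechanics.siteEnergy Literature.MathematicalPhysics.StatisticalMechanics.lennardJones (x N) i} : ℝ) / (N : ℝ)) Filter.atTop (nhds (0 : ℝ)) := by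
  intro e τ he hτ x hx
  exact hb_tendsto_looseDensity_zero he hτ x hx

end Summit.AtomisticToContinuum.Crystallization.Theorems.ZeroDefectDensityBirth

end
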